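import Literature.AlgebraicGeometry.HodgeTheory.FermatAokiClaimPStandardLeaves
import Literature.AlgebraicGeometry.HodgeTheory.CycleClassOfResolutions
import Literature.AlgebraicGeometry.HodgeTheory.ComplexOrientationFamily
import HarnessLib

/-!
# The `r`-cycle of Aoki's subvariety `Y ⊂ X^{p-1}ₘ` and Thm. 2-1 read as "`ω_σ([Y]) ≠ 0`"

Family `hodge`, layer `Literature/AlgebraicGeometry/HodgeTheory`. PROOF FILE (sequel of
`FermatAokiSubvarietyCodimension` and `FermatAokiClaimPStandardLeaves`; everything proved, no named
fact) for the leaf `Aoki1987_thm_2_1_supportedClass` of the named fact `Aoki1987_claim_pStandard` —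
N. Aoki, *Some new algebraic cycles on Fermat varieties*, J. Math. Soc. Japan 39 (1987) 385–396,
THEOREM 2-1 (p. 388): "The variety `Y` defined by (2.1) is a subvariety of `X^{p-1}ₘ` of
codimension `r` and it represents the class `σ_{p,a}`", where (p. 386) "`ω_α(Z) = P_α([Z])` …
if `ω_α(Z) ≠ 0`, we say that `Z` represents the class `α`", `[Z]` the cohomology class of the
algebraic cycle `Z`.

The leaf asks for SOME class supported on `Y = Y_{c₀} ∩ X²ʳₘ` (`Aoki1987.fermatAokiSection`) with
non-zero `σ_{p,a}`-component. This file pins the class Aoki means, on the tree's carriers: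

* `Aoki1987.fermatAokiTop m r d c` — the points of `Y ∩ X²ʳₘ` of dimension `r` (the generic points
  of its `r`-dimensional components; every point of `Y` has dimension `≤ r`,
  `Aoki1987.height_le_of_mem_fermatAokiSection`, from `codim ≥ r` of
  `FermatAokiSubvarietyCodimension`), a FINITE set (`Aoki1987.finite_fermatAokiTop`: they are
  generic points of irreducible components of the Noetherian closed set `Y`);
* `Aoki1987.fermatAokiCycle` — **the `r`-cycle `[Y] = Σ [Yᵢ] ∈ Z_r(X²ʳₘ)`** of `Y` (its
  `r`-dimensional components with multiplicity one; Aoki's `Y` is a variety, Prop. 3-1, so in print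
  this is the prime cycle `[Y]`), an element of the tree's `Motives.cyclesOfDim`, supported on `Y`
  (`Aoki1987.mem_fermatAokiSection_of_fermatAokiCycle_ne_zero`);
* **`Aoki1987_thm_2_1_supportedClass_of_projector_cycleClass_ne_zero`** — the leaf follows from
  the printed statement "`Y` represents `σ_{p,a}`", i.e. `ω_σ([Y]) = P_σ(cl [Y]) ≠ 0` for the tree's
  cycle class `cycleClass complexOrientationFamily` (`HodgeTheory/CycleClassOfResolutions`, Voisin I
  §11.1.4: `[Z] = Σ nᵢ τᵢ_* 1` through desingularisations) of `[Y]` for some `c₀` (in print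
  `c₀ = εᵖ ᵈ√p`): that class is supported on `Y` (`cycleClass_restrictCompl_eq_zero`, Voisin II,
  proof of Lemma 9.18).

What is NOT here: `ω_σ([Y]) ≠ 0` itself — in print `ω_σ(Y)·\overline{ω_σ(Y)} = (-1)ʳ p^{p-2} mᵖ`
(§4: the intersection numbers `I(Y, Yᵍ)`, `g ∈ G^{p-1}ₘ`, the degree `deg Y = p·r!·dʳ` and
`G_Y = G₀ ∩ Ker σ` of Prop. 3-1, Fourier inversion over `G/G_Y`), which needs the compatibility of
the cycle class with intersection products (Fulton Cor. 19.2), not in the tree; and `[Y] ≠ 0`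
(`dim Y = r`, the other half of "codimension `r`").

## References

* [Aoki1987] N. Aoki, Some new algebraic cycles on Fermat varieties, J. Math. Soc. Japan 39 (1987)
  385–396: p. 386 (`ω_α(Z) = P_α([Z])`, "represents"), (2.1) and Thm. 2-1 (p. 388), Prop. 3-1
  (p. 389), §4.
* [VoisinHodgeI2002] C. Voisin, Hodge Theory and Complex Algebraic Geometry I, CUP 2002, §11.1.4.
* [VoisinHodgeII2003] C. Voisin, Hodge Theory and Complex Algebraic Geometry II, CUP 2003, proof of
  Lemma 9.18 (support of the cycle class).
* [Fulton1998] W. Fulton, Intersection Theory, 2nd ed. 1998, §1.5 (cycle of a subscheme).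
-/

noncomputable section

open CategoryTheory AlgebraicGeometry Order

namespace Literature.AlgebraicGeometry.HodgeTheory

open Literature.AlgebraicGeometry.Motives Literature.AlgebraicTopology.SingularHomology

namespace Aoki1987

variable {m r d : ℕ}

/-! ### Dimensions of points of `X²ʳₘ` and of `Y` -/

/-- On the smooth irreducible `2r`-fold `X²ʳₘ` (`r, m ≥ 1`), `dim {z}⁻ + codim {z}⁻ = 2r` for every
point `z` (Hartshorne II Ex. 3.20 through `Motives.height_add_coheight_eq_of_smoothOfRelativeDimension`).
[folklore] -/
theorem height_add_coheight_eq (hr : 0 < r) (hm : 1 ≤ m) (z : ↥(fermatHypersurface (2 * r) m).left) :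
    Order.height z + Order.coheight z = (2 * r : ℕ) := by
  have hX : IsSmoothProjective (2 * r) (fermatHypersurface (2 * r) m) :=
    isSmoothProjective_fermatHypersurface (by omega) hm
  haveI := hX.smoothOfRelativeDimension
  haveI := hX.geometricallyIrreducible
  haveI : IrreducibleSpace ↥(fermatHypersurface (2 * r) m).left :=
    GeometricallyIrreducible.irreducibleSpace_of_subsingleton (fermatHypersurface (2 * r) m).hom
  exact Motives.height_add_coheight_eq_of_smoothOfRelativeDimension (fermatHypersurface (2 * r) m).hom
    (2 * r) z

/-- Points of `X²ʳₘ` have finite dimension. [folklore] -/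
theorem height_ne_top (hr : 0 < r) (hm : 1 ≤ m) (z : ↥(fermatHypersurface (2 * r) m).left) :
    Order.height z ≠ ⊤ :=
  (lt_of_le_of_lt (le_self_add.trans (height_add_coheight_eq hr hm z).le) (ENat.coe_lt_top _)).ne

/-- **Every point of `Y ∩ X²ʳₘ` has dimension `≤ r`** (`codim ≥ r`,
`Aoki1987.le_coheight_of_mem_fermatAokiSection`, and `dim + codim = 2r`): Aoki's "`Y` … of
codimension `r`", dimension half (Prop. 3-1). [cite: Aoki1987, Thm. 2-1 (p. 388) and Prop. 3-1 (p. 389)] -/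
theorem height_le_of_mem_fermatAokiSection (hr : 0 < r) (hm : 1 ≤ m) (hd : 0 < d) (c : ℂ)
    {z : ↥(fermatHypersurface (2 * r) m).left} (hz : z ∈ fermatAokiSection m r d c) :
    Order.height z ≤ (r : ℕ∞) := by
  have hsum := height_add_coheight_eq hr hm z
  have hco : (r : ℕ∞) ≤ Order.coheight z := le_coheight_of_mem_fermatAokiSection hm hd c hz
  have hfin : Order.height z ≠ ⊤ := height_ne_top hr hm z
  obtain ⟨n, hn⟩ := ENat.ne_top_iff_exists.mp hfin
  rw [← hn] at hsum ⊢
  by_contra hlt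
  push Not at hlt
  have h1 : (r : ℕ∞) < n := hlt
  have h2 : ((n : ℕ∞) + r) ≤ (2 * r : ℕ) := by
    calc ((n : ℕ∞) + r) ≤ (n : ℕ∞) + Order.coheight z := add_le_add le_rfl hco
      _ = (2 * r : ℕ) := hsum
  have h3 : n + r ≤ 2 * r := by exact_mod_cast h2
  have h4 : r < n := by exact_mod_cast h1
  omega

/-! ### The `r`-dimensional points of `Y` and the cycle `[Y]` -/

variable (m r d) in
/-- **The `r`-dimensional points of `Y ∩ X²ʳₘ`** (the generic points of the `r`-dimensional
components of Aoki's `Y`; in print `Y` is irreducible of dimension `r`, so this is `{η_Y}`).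
[cite: Aoki1987, Thm. 2-1 (p. 388)] -/
def fermatAokiTop (c : ℂ) : Set ↥(fermatHypersurface (2 * r) m).left :=
  {z | z ∈ fermatAokiSection m r d c ∧ Order.height z = (r : ℕ∞)}

/-- `fermatAokiTop ⊆ Y`. [folklore] -/
theorem fermatAokiTop_subset (c : ℂ) : fermatAokiTop m r d c ⊆ fermatAokiSection m r d c :=
  fun _ hz ↦ hz.1

/-- **The `r`-dimensional points of `Y` form a finite set**: each is the generic point of an
irreducible component of the Noetherian sober closed subspace `Y ∩ X²ʳₘ` (a point of `Y`
specialising it has dimension `≤ r`, hence equals it), and these components are finite in number.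
[folklore] -/
theorem finite_fermatAokiTop (hr : 0 < r) (hm : 1 ≤ m) (hd : 0 < d) (c : ℂ) :
    (fermatAokiTop m r d c).Finite := by
  have hX : IsSmoothProjective (2 * r) (fermatHypersurface (2 * r) m) :=
    isSmoothProjective_fermatHypersurface (by omega) hm
  haveI := Motives.IsSmoothProjective.isLocallyNoetherian_holds hX
  haveI := Motives.IsSmoothProjective.compactSpace_holds hX
  haveI : IsNoetherian (fermatHypersurface (2 * r) m).left := {}
  set S : Set ↥(fermatHypersurface (2 * r) m).left := fermatAokiSection m r d c with hSdef
  have hS : IsClosed S := isClosed_fermatAokiSection r d c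
  haveI : QuasiSober S := hS.isClosedEmbedding_subtypeVal.quasiSober
  haveI : Finite (irreducibleComponents S) :=
    (TopologicalSpace.NoetherianSpace.finite_irreducibleComponents (α := S)).to_subtype
  let G : Set ↥(fermatHypersurface (2 * r) m).left :=
    Set.range fun t : irreducibleComponents S ↦ ((t.2.1.genericPoint : S) : ↥(fermatHypersurface (2 * r) m).left)
  have hGfin : G.Finite := Set.finite_range _
  have hGS : G ⊆ S := by rintro _ ⟨t, rfl⟩; exact Subtype.prop _
  have hGcover : ∀ z ∈ S, ∃ η ∈ G, η ⤳ z := by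
    intro z hz
    have ht : irreducibleComponent (⟨z, hz⟩ : S) ∈ irreducibleComponents S :=
      irreducibleComponent_mem_irreducibleComponents _
    refine ⟨_, ⟨⟨_, ht⟩, rfl⟩, ?_⟩
    have hgen : IsGenericPoint ht.1.genericPoint (closure (irreducibleComponent (⟨z, hz⟩ : S))) :=
      ht.1.isGenericPoint_genericPoint_closure
    rw [isClosed_irreducibleComponent.closure_eq] at hgen
    exact (hgen.specializes mem_irreducibleComponent).map continuous_subtype_val
  refine hGfin.subset fun z hz ↦ ?_
  obtain ⟨η, hηG, hηz⟩ := hGcover z hz.1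
  have hle : z ≤ η := Scheme.le_iff_specializes.2 hηz
  have hηr : Order.height η ≤ (r : ℕ∞) := height_le_of_mem_fermatAokiSection hr hm hd c (hGS hηG)
  by_cases hlt : z < η
  · have h1 : Order.height z < Order.height η :=
      Order.height_strictMono hlt (lt_top_iff_ne_top.2 (height_ne_top hr hm z))
    rw [hz.2] at h1
    exact absurd hηr (not_le.mpr h1)
  · have hge : η ≤ z := by
      by_contra hne
      exact hlt (lt_iff_le_not_ge.2 ⟨hle, hne⟩)
    have hzη : z ⤳ η := Scheme.le_iff_specializes.1 hge
    have hins : Inseparable η z := le_antisymm hηz hzη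
    rw [← hins.eq]
    exact hηG

/-- **The `r`-cycle `[Y] = Σᵢ [Yᵢ] ∈ Z_r(X²ʳₘ)` of Aoki's `Y ∩ X²ʳₘ`**: the sum of the prime cycles of
its `r`-dimensional points (the `r`-dimensional components of `Y`, each with multiplicity one — the
cycle of the variety `Y` of Thm. 2-1, "a subvariety of `X^{p-1}ₘ` of codimension `r`"; `r, m, d ≥ 1`).
[cite: Aoki1987, Thm. 2-1 (p. 388)] [cite: Fulton1998, §1.5] -/
def fermatAokiCycle (hr : 0 < r) (hm : 1 ≤ m) (hd : 0 < d) (c : ℂ) :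
    ↥(Motives.cyclesOfDim (fermatHypersurface (2 * r) m).left r) :=
  ⟨∑ z ∈ (finite_fermatAokiTop hr hm hd c).toFinset, Motives.primeCycle z,
    AddSubgroup.sum_mem _ fun _ hz ↦ Motives.primeCycle_mem_cyclesOfDim
      ((finite_fermatAokiTop hr hm hd c).mem_toFinset.mp hz).2⟩

open Classical in
/-- The coefficients of `[Y]`: `1` at the `r`-dimensional points of `Y`, `0` elsewhere. [folklore] -/
theorem fermatAokiCycle_apply (hr : 0 < r) (hm : 1 ≤ m) (hd : 0 < d) (c : ℂ)
    (z : ↥(fermatHypersurface (2 * r) m).left) :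
    (fermatAokiCycle hr hm hd c : AlgebraicCycle (fermatHypersurface (2 * r) m).left ℤ) z =
      if z ∈ fermatAokiTop m r d c then 1 else 0 := by
  change (∑ w ∈ (finite_fermatAokiTop hr hm hd c).toFinset, Motives.primeCycle w :
    AlgebraicCycle (fermatHypersurface (2 * r) m).left ℤ) z = _
  rw [Function.locallyFinsuppWithin.coe_sum, Finset.sum_apply]
  split_ifs with h
  · rw [Finset.sum_eq_single_of_mem z ((finite_fermatAokiTop hr hm hd c).mem_toFinset.mpr h)
      fun w _ hw ↦ Motives.primeCycle_apply_of_ne (Ne.symm hw)]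
    exact Motives.primeCycle_apply_self z
  · exact Finset.sum_eq_zero fun w hw ↦ Motives.primeCycle_apply_of_ne fun hzw ↦
      h (hzw ▸ (finite_fermatAokiTop hr hm hd c).mem_toFinset.mp hw)

/-- **`[Y]` is supported on `Y`**: a point with non-zero coefficient is an `r`-dimensional point of
`Y`, in particular lies on `Y ∩ X²ʳₘ`. [cite: Aoki1987, Thm. 2-1 (p. 388)] -/
theorem mem_fermatAokiSection_of_fermatAokiCycle_ne_zero (hr : 0 < r) (hm : 1 ≤ m) (hd : 0 < d)
    (c : ℂ) {z : ↥(fermatHypersurface (2 * r) m).left}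
    (hz : (fermatAokiCycle hr hm hd c : AlgebraicCycle (fermatHypersurface (2 * r) m).left ℤ) z ≠ 0) :
    z ∈ fermatAokiSection m r d c := by
  classical
  rw [fermatAokiCycle_apply] at hz
  by_cases h : z ∈ fermatAokiTop m r d c
  · exact h.1
  · rw [if_neg h] at hz
    exact absurd rfl hz

/-- `[Y] ≠ 0` as soon as `Y` has an `r`-dimensional point. [folklore] -/
theorem fermatAokiCycle_ne_zero_of_mem (hr : 0 < r) (hm : 1 ≤ m) (hd : 0 < d) (c : ℂ)
    {z : ↥(fermatHypersurface (2 * r) m).left} (hz : z ∈ fermatAokiTop m r d c) :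
    fermatAokiCycle hr hm hd c ≠ 0 := by
  classical
  intro h
  have h1 := fermatAokiCycle_apply hr hm hd c z
  rw [h, if_pos hz] at h1
  exact zero_ne_one h1

end Aoki1987

/-! ### Thm. 2-1 read as "`Y` represents `σ_{p,a}`": the leaf from `ω_σ([Y]) ≠ 0` -/

/-- **`Aoki1987_thm_2_1_supportedClass` from "`Y` represents `σ_{p,a}`".** Granted, for
`p = 2r + 1` prime, `p ∣ m`, `d = m/p > 2`, `(⟨a⟩, d) = 1` (and the proof-irrelevant bookkeeping
`hX`, `hrr`, a resolution family `ρ` through which the tree's cycle class is computed), that for some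
constant `c₀` (in print `c₀ = εᵖ ᵈ√p`, `c₀ᵈ = -p`) the `σ_{p,a}`-component of the cycle class of the
`r`-cycle `[Y]` of Aoki's `Y = Y_{c₀} ∩ X²ʳₘ` is non-zero — "`ω_α(Z) = P_α([Z])` … `Z` represents the
class `α`" (p. 386), THEOREM 2-1: "`Y` … represents the class `σ_{p,a}`. More precisely we have
`ω_σ(Y)·\overline{ω_σ(Y)} = (-1)ʳ p^{p-2} mᵖ`" — the leaf holds: `cl [Y]` is supported on the
Zariski-closed `Y` (`cycleClass_restrictCompl_eq_zero`; every point with non-zero coefficient lies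
on `Y`, `Aoki1987.mem_fermatAokiSection_of_fermatAokiCycle_ne_zero`).
[cite: Aoki1987, Thm. 2-1 (p. 388) and p. 386 (ω_α(Z) = P_α([Z]), "represents")]
[cite: VoisinHodgeII2003, proof of Lemma 9.18 (support of the cycle class)] -/
theorem Aoki1987_thm_2_1_supportedClass_of_projector_cycleClass_ne_zero
    (h : ∀ (m r : ℕ) [NeZero m] (hr : 0 < r) (hm : 1 ≤ m) (hd : 0 < m / (2 * r + 1))
      (hX : IsSmoothProjective (2 * r) (fermatHypersurface (2 * r) m)) (hrr : r + r = 2 * r)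
      (ρ : ResolutionFamily (fermatHypersurface (2 * r) m) r),
      (2 * r + 1).Prime → 2 * r + 1 ∣ m → 2 < m / (2 * r + 1) →
      ∀ a : ZMod m, Nat.Coprime a.val (m / (2 * r + 1)) →
      ∃ c₀ : ℂ, fermatProjector m (FermatCharacter.aokiStandard r m a) (2 * r)
        (cycleClass complexOrientationFamily hX hrr ρ
          (Aoki1987.fermatAokiCycle hr hm hd c₀)) ≠ 0) :
    Aoki1987_thm_2_1_supportedClass := by
  intro m r _ hp hpm hd a ha
  have hr : 0 < r := by
    rcases Nat.eq_zero_or_pos r with rfl | h'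
    · exact absurd hp (by decide)
    · exact h'
  have hm : 1 ≤ m := NeZero.one_le
  have hd0 : 0 < m / (2 * r + 1) := by omega
  have hX : IsSmoothProjective (2 * r) (fermatHypersurface (2 * r) m) :=
    isSmoothProjective_fermatHypersurface (by omega) hm
  obtain ⟨ρ⟩ := nonempty_resolutionFamily hX r
  obtain ⟨c₀, hne⟩ := h m r hr hm hd0 hX (two_mul r).symm ρ hp hpm hd a ha
  exact ⟨c₀, _, cycleClass_restrictCompl_eq_zero complexOrientationFamily hX (two_mul r).symm ρ _
    (Aoki1987.isClosed_fermatAokiSection r _ c₀)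
    (fun z hz ↦ Aoki1987.mem_fermatAokiSection_of_fermatAokiCycle_ne_zero hr hm hd0 c₀ hz), hne⟩

end Literature.AlgebraicGeometry.HodgeTheory

end
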